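import Literature.NumberTheory.Automorphic.KirillovL2BoundFinite
import Literature.NumberTheory.Automorphic.TorusIntegrandGL2Pointwise
import Literature.NumberTheory.Automorphic.TorusIntegrandGL2PhiBound
import Literature.NumberTheory.Automorphic.SmoothedVectorUnderMaximalCompact
import Literature.NumberTheory.Automorphic.TorusSecondCoordinateIntegral
import Literature.NumberTheory.Automorphic.HaarShearFinTwo
import Literature.NumberTheory.Automorphic.PairLFunctionPolesEqConjFirstMoment
import Literature.NumberTheory.Automorphic.RankinSelbergTowerComparison
import Literature.NumberTheory.Automorphic.LocalComponentBJExistsProofs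
import Literature.NumberTheory.Automorphic.WhittakerSupportFinite
import Literature.NumberTheory.Automorphic.NormOneTorusAdelicCompact
import Literature.NumberTheory.Automorphic.GLnCuspidalSpectrumSiegel
import Literature.NumberTheory.Automorphic.CuspidalTestVector
import HarnessLib

/-!
# From the Kirillov `L²`-bound to the bad-place Rankin–Selberg torus integral of `GL_2` at `s = 1`

Topic `NumberTheory/Automorphic`; namespace `Literature.NumberTheory.Automorphic`. Theorems only. The
assembly of the `n = 2` case of the hypothesis `hfin` of
`PairLFunctionPolesEqConjFirstMoment.JacquetShalika1981_partialPairL_pole_of_eq_conj_of_firstMoment`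
(named fact `JacquetShalika1981_partialPairL_pole_of_eq_conj`, Arthur–Clozel (1989), Ch. 3 (2.3)) from
the Kirillov `L²`-bound `KirillovL2BoundFinite.exists_kirillovL2Bound` (Jacquet–Shalika (1981), §4–§5
in rank `2`):

* `yPart_tsum_lintegral_le` — for a test function `η` invariant under conjugation by `K_∞` and of
  level `K(𝔫)`, a Haar measure `ν₁` on `𝕀_K` and a Haar measure `ν_K` on `K`:
  `Σ_{m ∈ ℤ^{S'}} ∫_K ∫_{𝕌_K} |W_{S_η f}(diag(ϖ^m b, 1) k)|² dν₁(b) dν_K(k) < ∞`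
  (absorb `diag(b_f, 1) ∈ K` into `k` by the invariance of `ν_K`, push `ν₁|_{𝕌_K}` forward to `K_∞ˣ`
  (`UnitIdeleArchPushforward`), move `k` onto the weight (`W(g k) = W_{S_{L_k η} f}(g)`), apply the
  Kirillov bound to `L_k η` (level `K(𝔫)`, normalised by `GL_2(𝒪̂)`) and bound the words uniformly in
  `k` (`SmoothedVectorUnderMaximalCompact`)).

## References

* H. Jacquet, J. A. Shalika, Amer. J. Math. 103 (1981), §4–§5 [JacquetShalikaAJM1981].
* J. Arthur, L. Clozel, Ann. of Math. Stud. 120 (1989), Ch. 3 §2, (2.3), p. 171 [ArthurClozelAMS120].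
-/

noncomputable section

open MeasureTheory Measure NumberField NumberField.mixedEmbedding IsDedekindDomain Matrix Set Filter Topology WithZero
open scoped MatrixGroups ENNReal NNReal ComplexConjugate Classical
open Literature.NumberTheory.GaloisRepresentations (ideleGroup unitIdeles localUnits)

namespace Literature.NumberTheory.Automorphic

-- the automorphic quotient carries the tree's Borel σ-algebra, not Mathlib's quotient σ-algebra
attribute [-instance] Quotient.instMeasurableSpace QuotientGroup.measurableSpace

-- the house local instances: Borel structures of `GL_n(𝔸_K)` in both spellings and of `K_∞ˣ`
attribute [local instance] adelicBorel borelSpace_adelic locallyCompactSpace_adelic secondCountableTopology_gl_adelic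
  glAdeleBorel borelSpace_glAdele
attribute [local instance] Literature.MeasureTheory.Group.Units.borelSpace_of_isOpenEmbedding
  Literature.MeasureTheory.Group.hasSummableGeomSeries_of_finiteDimensional
attribute [local instance 100] LieRing.ofAssociativeRing

set_option backward.isDefEq.respectTransparency false
set_option synthInstance.maxHeartbeats 400000

/-! ### Algebraic helpers -/

section Helpers

variable {K : Type} [Field K] [NumberField K]

/-- An element of `K` as an element of `GL_2(𝔸_K)`. [folklore] -/
def kGL (k : ↥(maximalCompactAdelic 2 K)) : GL (Fin 2) (AdeleRing (𝓞 K) K) :=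
  show GL (Fin 2) (AdeleRing (𝓞 K) K) from (k : (AdelicGroupData.gl 2 K).Adelic)

/-- Unfolding. [folklore] -/
theorem kGL_mul (k k' : ↥(maximalCompactAdelic 2 K)) : kGL (k * k') = kGL k * kGL k' := rfl

/-- `kGL k ∈ K`. [folklore] -/
theorem kGL_mem (k : ↥(maximalCompactAdelic 2 K)) : kGL k ∈ maximalCompactAdelic 2 K := k.2

/-- `t ↦ diag(t, 1)` is continuous on `𝕀_K`. [folklore] -/
theorem continuous_glDiagonal_vec2 : Continuous fun t : ideleGroup K => glDiagonal 2 (AdeleRing (𝓞 K) K) ![t, 1] := by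
  refine (continuous_glDiagonal (n := 2) (AdeleRing (𝓞 K) K)).comp (continuous_pi fun i => ?_)
  fin_cases i
  · exact continuous_id
  · exact continuous_const

/-- The archimedean dilation commutes with the torus shell products. [folklore] -/
theorem commute_archDilationGL_torusShellProd (ϖ : ∀ v : HeightOneSpectrum (𝓞 K), (v.adicCompletion K)ˣ)
    (T : Finset (HeightOneSpectrum (𝓞 K))) (m : ↥T → ℤ) (x : (mixedSpace K)ˣ) :
    Commute (archDilationGL K x) (torusShellProd ϖ T m) := by
  unfold torusShellProd
  refine Finset.noncommProd_commute _ _ _ _ fun v _ => ?_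
  show Commute (GLn.ofInfinite 2 K (diagGL2 x 1)) (GLn.ofLocal 2 K v (glDiagonal 2 (v.adicCompletion K) ![ϖ v ^ extendShell m v, 1]))
  rw [← GLn.ofFinite_sndHom_ofLocal]
  exact GLn.commute_ofInfinite_ofFinite _ _

/-- **`diag(ϖ^m b, 1) k = (a(b_∞) ∏ ι_v a(ϖ_v^{m_v})) · (diag(b_f, 1) k)`.** [folklore] -/
theorem glDiagonal_shellIdele_mul_mul (ϖ : ∀ v : HeightOneSpectrum (𝓞 K), (v.adicCompletion K)ˣ)
    (S' : Finset (HeightOneSpectrum (𝓞 K))) (m : ↥S' → ℤ) (b : ideleGroup K) (k : GL (Fin 2) (AdeleRing (𝓞 K) K)) :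
    glDiagonal 2 (AdeleRing (𝓞 K) K) ![shellIdele ϖ S' m * b, 1] * k =
      archDilationGL K (archUnitsOfIdele K b) * torusShellProd ϖ S' m * (glDiagonal 2 (AdeleRing (𝓞 K) K) ![finUnitPart b, 1] * k) := by
  rw [glDiagonal_shellIdele_mul, (commute_archDilationGL_torusShellProd ϖ S' m _).eq]
  simp only [mul_assoc]

/-- **`L_k η` has level `K_f(𝔫)` for `k ∈ K`** when `η` has level `K(𝔫)` (the principal congruence
subgroup is normalised by `GL_2(𝒪̂)`). [folklore] -/
theorem leftTranslateWeight_level_of_mem_maximalCompactAdelic {η : (AdelicGroupData.gl 2 K).Adelic → ℝ} {𝔫 : Ideal (𝓞 K)}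
    (hηK : ∀ u ∈ principalCongruenceLevel 2 K 𝔫, ∀ g : GL (Fin 2) (AdeleRing (𝓞 K) K), η (u * g) = η g)
    {k : GL (Fin 2) (AdeleRing (𝓞 K) K)} (hk : k ∈ maximalCompactAdelic 2 K) :
    ∀ u ∈ finitePrincipalCongruenceLevel 2 K 𝔫, ∀ g : GL (Fin 2) (AdeleRing (𝓞 K) K),
      leftTranslateWeight (n := 2) k η (GLn.ofFinite 2 K u * g) = leftTranslateWeight (n := 2) k η g := by
  intro u hu g
  have hk' : k ∈ (standardMaximalCompactGL 2 K : Set (GL (Fin 2) (AdeleRing (𝓞 K) K))) := hk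
  rw [coe_standardMaximalCompactGL_eq_mul] at hk'
  obtain ⟨a, ha, b, hb, rfl⟩ := Set.mem_mul.1 hk'
  obtain ⟨κ, -, rfl⟩ := Subgroup.mem_map.1 ha
  have hbf : GLn.sndHom 2 K b ∈ glFiniteIntegralLevel 2 K := (mem_glIntegralLevel_iff.1 hb).1
  have hbeq : b = GLn.ofFinite 2 K (GLn.sndHom 2 K b) := GLn.eq_ofFinite_sndHom_of_fstHom_eq_one (mem_glIntegralLevel_iff.1 hb).2
  have huK : GLn.ofFinite 2 K u ∈ principalCongruenceLevel 2 K 𝔫 := by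
    rw [← map_ofFinite_finitePrincipalCongruenceLevel]; exact Subgroup.mem_map_of_mem _ hu
  have hu' : b⁻¹ * GLn.ofFinite 2 K u * b ∈ principalCongruenceLevel 2 K 𝔫 := by
    rw [hbeq]; exact inv_mul_mul_mem_principalCongruenceLevel huK hbf
  simp only [leftTranslateWeight]
  have e : (GLn.ofInfinite 2 K κ * b)⁻¹ * (GLn.ofFinite 2 K u * g) =
      (b⁻¹ * GLn.ofFinite 2 K u * b) * ((GLn.ofInfinite 2 K κ * b)⁻¹ * g) := by
    have hc := (GLn.commute_ofInfinite_ofFinite (n := 2) (K := K) κ u).inv_left.eq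
    simp only [_root_.mul_inv_rev, mul_assoc, mul_inv_cancel_left]
    rw [← mul_assoc (GLn.ofInfinite 2 K κ)⁻¹, hc, mul_assoc]
  rw [e, hηK _ hu']

end Helpers

/-! ### The first torus coordinate: shells, the compact subgroup and the Kirillov bound -/

section YPart

variable {K : Type} [Field K] [NumberField K]
variable {μ : Measure (AdelicGroupData.gl 2 K).automorphicQuotient} [(AdelicGroupData.gl 2 K).IsAutomorphicMeasure μ]
variable [MeasurableSpace (AdeleRing (𝓞 K) K)] [BorelSpace (AdeleRing (𝓞 K) K)]

/-- `Ψ_m(k, x) = |W(a(x) T_m k)|²`. [folklore] -/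
def shellPsi (Wf : GL (Fin 2) (AdeleRing (𝓞 K) K) → ℂ) (ϖ : ∀ v : HeightOneSpectrum (𝓞 K), (v.adicCompletion K)ˣ)
    (S' : Finset (HeightOneSpectrum (𝓞 K))) (m : ↥S' → ℤ) (k : ↥(maximalCompactAdelic 2 K)) (x : (mixedSpace K)ˣ) : ℝ≥0∞ :=
  ‖Wf (archDilationGL K x * torusShellProd ϖ S' m * kGL k)‖ₑ ^ 2

/-- The uniform bound `Σ_u (‖η_u‖_{L¹} ‖f‖)²` on the words. [folklore] -/
def wordsBound (W : ContRepresentation.ClosedSubrep ((AdelicGroupData.gl 2 K).rightRegular μ)) (f : W.toSubmodule)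
    (η : (AdelicGroupData.gl 2 K).Adelic → ℝ)
    (𝒰 : Finset (List (AutomorphyDatum.gl 2 K (isCompact_glFiniteIntegralLevel_holds 2 K)).arch.lie)) : ℝ≥0∞ :=
  ∑ u ∈ 𝒰, ENNReal.ofReal (((∫ g, ‖((wordDerivWeight (AutomorphyDatum.gl 2 K (isCompact_glFiniteIntegralLevel_holds 2 K)).ofArch u η g : ℝ) : ℂ)‖
    ∂(adelicHaar 2 K)) * ‖f‖) ^ 2)

omit [MeasurableSpace (AdeleRing (𝓞 K) K)] [BorelSpace (AdeleRing (𝓞 K) K)] in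
/-- The words bound is finite. [folklore] -/
theorem wordsBound_ne_top (W : ContRepresentation.ClosedSubrep ((AdelicGroupData.gl 2 K).rightRegular μ)) (f : W.toSubmodule)
    (η : (AdelicGroupData.gl 2 K).Adelic → ℝ)
    (𝒰 : Finset (List (AutomorphyDatum.gl 2 K (isCompact_glFiniteIntegralLevel_holds 2 K)).arch.lie)) : wordsBound W f η 𝒰 ≠ ⊤ :=
  ENNReal.sum_ne_top.2 fun _ _ => ENNReal.ofReal_ne_top

set_option maxHeartbeats 1600000 in
/-- **The `y`-part is finite.** For a test function `η` invariant under conjugation by `K_∞` and of level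
`K(𝔫)`, Haar measures `ν₁` on `𝕀_K`, `ν_K` on `K`, `ν₀` on `N_2(𝔸_K)`, uniformizers `ϖ` and a finite
set `S'`:
`Σ_{m ∈ ℤ^{S'}} ∫_K ∫_{𝕌_K} |W_{S_η f}(diag(ϖ^m b, 1) k)|² dν₁(b) dν_K(k) < ∞`. [cite: JacquetShalikaAJM1981, §4–§5] -/
theorem yPart_tsum_lintegral_lt_top
    (W : ContRepresentation.ClosedSubrep ((AdelicGroupData.gl 2 K).rightRegular μ)) (f : W.toSubmodule)
    {η : (AdelicGroupData.gl 2 K).Adelic → ℝ} (hη : IsTestFunctionGL 2 K η)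
    (had : ∀ (κ : (AutomorphyDatum.gl 2 K (isCompact_glFiniteIntegralLevel_holds 2 K)).arch.maximalCompact)
      (g : (AdelicGroupData.gl 2 K).Adelic),
      η ((AutomorphyDatum.gl 2 K (isCompact_glFiniteIntegralLevel_holds 2 K)).ofK κ * g *
        ((AutomorphyDatum.gl 2 K (isCompact_glFiniteIntegralLevel_holds 2 K)).ofK κ)⁻¹) = η g)
    {𝔫 : Ideal (𝓞 K)} (h𝔫 : 𝔫 ≠ 0) (hηK : ∀ u ∈ principalCongruenceLevel 2 K 𝔫, ∀ g : GL (Fin 2) (AdeleRing (𝓞 K) K), η (u * g) = η g)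
    (ν₁ : Measure (ideleGroup K)) [IsHaarMeasure ν₁]
    (νK : Measure ↥(maximalCompactAdelic 2 K)) [IsHaarMeasure νK]
    (ν₀ : Measure ↥(adelicUnipotent 2 K)) [IsHaarMeasure ν₀]
    (ϖ : ∀ v : HeightOneSpectrum (𝓞 K), (v.adicCompletion K)ˣ)
    (hϖ : ∀ v, Valued.v ((ϖ v : (v.adicCompletion K)ˣ) : v.adicCompletion K) = exp (-1 : ℤ))
    (S' : Finset (HeightOneSpectrum (𝓞 K))) :
    ∑' m : ↥S' → ℤ, ∫⁻ b in (unitIdeles K : Set (ideleGroup K)), ∫⁻ k,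
      ‖whittakerCoeff ν₀ (unipotentTateDomain 2 K) (adeleAddChar K)
          (invQuot (AdelicGroupData.gl 2 K) (smoothedForm η (f : (AdelicGroupData.gl 2 K).L2 μ)))
          (glDiagonal 2 (AdeleRing (𝓞 K) K) ![shellIdele ϖ S' m * b, 1] * kGL k)‖ₑ ^ 2 ∂νK ∂ν₁ < ⊤ := by
  have hc₀ : isCompact_glFiniteIntegralLevel 2 K := isCompact_glFiniteIntegralLevel_holds 2 K
  -- topological and measurable structures
  haveI : T2Space (GL (Fin 2) (AdeleRing (𝓞 K) K)) := t2Space_gl 2 K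
  haveI : T2Space (AdeleRing (𝓞 K) K) := t2Space_adeleRing K
  haveI := borelSpace_ideleGroup K
  haveI := locallyCompactSpace_ideleGroup K
  haveI := secondCountableTopology_ideleGroup K
  haveI : CompactSpace ↥(maximalCompactAdelic 2 K) := isCompact_iff_compactSpace.1 (isCompact_maximalCompactAdelic 2 K)
  haveI : SecondCountableTopology ↥(maximalCompactAdelic 2 K) := TopologicalSpace.Subtype.secondCountableTopology _
  haveI : BorelSpace (mixedSpace K)ˣ := Literature.MeasureTheory.Group.Units.borelSpace_of_isOpenEmbedding
  -- the Whittaker coefficient and its continuity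
  set Wf : GL (Fin 2) (AdeleRing (𝓞 K) K) → ℂ := whittakerCoeff ν₀ (unipotentTateDomain 2 K) (adeleAddChar K)
    (invQuot (AdelicGroupData.gl 2 K) (smoothedForm η (f : (AdelicGroupData.gl 2 K).L2 μ))) with hWf
  have hψ : IsGlobalAddChar K (adeleAddChar K) := isGlobalAddChar_adeleAddChar (K := K)
  have hWc : Continuous Wf := continuous_whittakerCoeff measurableSet_unipotentTateDomain isCompact_closure_unipotentTateDomain
    hψ.continuous (continuous_invQuot_smoothedForm hη.continuous hη.hasCompactSupport _)
  -- the level and the Kirillov bound at that level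
  obtain ⟨C, hC, 𝒰, hKLB⟩ := exists_kirillovL2Bound (μ := μ) ν₀ ϖ hϖ S' (finitePrincipalCongruenceLevel 2 K 𝔫)
    (isOpen_finitePrincipalCongruenceLevel 2 K h𝔫) (isCompact_finitePrincipalCongruenceLevel 2 K h𝔫)
  -- the pushforward constant
  obtain ⟨c₂, hc₂⟩ := exists_setLIntegral_unitIdeles_eq_mul_lintegral_mixedUnits (K := K) ν₁
  -- the functions `Ψ_m(k, x) = |W(a(x) T_m k)|²`
  have hΨ : ∀ m k x, shellPsi Wf ϖ S' m k x = ‖Wf (archDilationGL K x * torusShellProd ϖ S' m * kGL k)‖ₑ ^ 2 := fun _ _ _ => rfl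
  have hΨm : ∀ m, Measurable fun p : ↥(maximalCompactAdelic 2 K) × (mixedSpace K)ˣ => shellPsi Wf ϖ S' m p.1 p.2 := by
    intro m
    have hc : Continuous fun p : ↥(maximalCompactAdelic 2 K) × (mixedSpace K)ˣ =>
        Wf (archDilationGL K p.2 * torusShellProd ϖ S' m * kGL p.1) :=
      hWc.comp ((((continuous_archDilationAdelic (K := K)).comp continuous_snd).mul continuous_const).mul
        (continuous_subtype_val.comp continuous_fst))
    exact (hc.measurable.enorm.pow_const 2)
  -- Step 1: for fixed `m`, the double integral is `c₂ ∫_K ∫_{K_∞ˣ} Ψ_m`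
  have hstep : ∀ m : ↥S' → ℤ,
      ∫⁻ b in (unitIdeles K : Set (ideleGroup K)), ∫⁻ k, ‖Wf (glDiagonal 2 (AdeleRing (𝓞 K) K) ![shellIdele ϖ S' m * b, 1] * kGL k)‖ₑ ^ 2 ∂νK ∂ν₁ =
        c₂ * ∫⁻ k, ∫⁻ x, shellPsi Wf ϖ S' m k x ∂mixedUnitsHaar K ∂νK := by
    intro m
    -- (b) on `𝕌_K`: absorb `diag(b_f, 1)` into `k`
    have hb : ∀ b ∈ (unitIdeles K : Set (ideleGroup K)),
        ∫⁻ k, ‖Wf (glDiagonal 2 (AdeleRing (𝓞 K) K) ![shellIdele ϖ S' m * b, 1] * kGL k)‖ₑ ^ 2 ∂νK =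
          ∫⁻ k, shellPsi Wf ϖ S' m k (archUnitsOfIdele K b) ∂νK := by
      intro b hb
      set d : ↥(maximalCompactAdelic 2 K) := ⟨glDiagonal 2 (AdeleRing (𝓞 K) K) ![finUnitPart b, 1],
        glIntegralLevel_le_standardMaximalCompactGL (glDiagonal_finUnitPart_mem_glIntegralLevel hb)⟩ with hd
      have he : ∀ k, ‖Wf (glDiagonal 2 (AdeleRing (𝓞 K) K) ![shellIdele ϖ S' m * b, 1] * kGL k)‖ₑ ^ 2 = shellPsi Wf ϖ S' m (d * k) (archUnitsOfIdele K b) := by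
        intro k
        rw [hΨ, glDiagonal_shellIdele_mul_mul, kGL_mul]
        rfl
      simp_rw [he]
      exact lintegral_mul_left_eq_self (fun k => shellPsi Wf ϖ S' m k (archUnitsOfIdele K b)) d
    rw [setLIntegral_congr_fun (GaloisRepresentations.isOpen_unitIdeles K).measurableSet hb]
    -- (c) pushforward to `K_∞ˣ`
    have h2 : Measurable fun p : (mixedSpace K)ˣ × ↥(maximalCompactAdelic 2 K) => shellPsi Wf ϖ S' m p.2 p.1 := by
      simpa only [Function.comp_def, Prod.fst_swap, Prod.snd_swap] using (hΨm m).comp measurable_swap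
    have hGm : Measurable fun x : (mixedSpace K)ˣ => ∫⁻ k, shellPsi Wf ϖ S' m k x ∂νK :=
      Measurable.lintegral_prod_right' (f := fun p : (mixedSpace K)ˣ × ↥(maximalCompactAdelic 2 K) => shellPsi Wf ϖ S' m p.2 p.1) h2
    rw [hc₂ _ hGm]
    -- (d) swap back
    congr 1
    have hsw : Measurable (Function.uncurry fun (x : (mixedSpace K)ˣ) (k : ↥(maximalCompactAdelic 2 K)) => shellPsi Wf ϖ S' m k x) := h2
    exact lintegral_lintegral_swap hsw.aemeasurable
  simp_rw [hstep]
  -- Step 2: sum over the shells inside the `k`-integral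
  rw [ENNReal.tsum_mul_left, ← lintegral_tsum fun m =>
    (Measurable.lintegral_prod_right' (f := fun p : ↥(maximalCompactAdelic 2 K) × (mixedSpace K)ˣ => shellPsi Wf ϖ S' m p.1 p.2) (hΨm m)).aemeasurable]
  -- Step 3: the Kirillov bound for `L_k η`, uniformly in `k`
  have hk : ∀ k : ↥(maximalCompactAdelic 2 K), ∑' m : ↥S' → ℤ, ∫⁻ x, shellPsi Wf ϖ S' m k x ∂mixedUnitsHaar K ≤ C * wordsBound W f η 𝒰 := by
    intro k
    set θ : GL (Fin 2) (AdeleRing (𝓞 K) K) → ℝ := leftTranslateWeight (n := 2) (kGL k) η with hθ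
    have hθt : IsTestFunctionGL 2 K θ := hη.leftTranslate _
    have hθU := leftTranslateWeight_level_of_mem_maximalCompactAdelic hηK (kGL_mem k)
    have hΨθ : ∀ m x, shellPsi Wf ϖ S' m k x = ‖whittakerCoeff ν₀ (unipotentTateDomain 2 K) (adeleAddChar K)
        (invQuot (AdelicGroupData.gl 2 K) (smoothedForm θ (f : (AdelicGroupData.gl 2 K).L2 μ)))
        (archDilationGL K x * torusShellProd ϖ S' m)‖ₑ ^ 2 := by
      intro m x
      rw [hΨ, hWf, hθ, whittakerCoeff_invQuot_smoothedForm_mul]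
    calc ∑' m : ↥S' → ℤ, ∫⁻ x, shellPsi Wf ϖ S' m k x ∂mixedUnitsHaar K
        = ∑' m : ↥S' → ℤ, ∫⁻ x, ‖whittakerCoeff ν₀ (unipotentTateDomain 2 K) (adeleAddChar K)
            (invQuot (AdelicGroupData.gl 2 K) (smoothedForm θ (f : (AdelicGroupData.gl 2 K).L2 μ)))
            (archDilationGL K x * torusShellProd ϖ S' m)‖ₑ ^ 2 ∂mixedUnitsHaar K := by simp_rw [hΨθ]
      _ ≤ C * ∑ u ∈ 𝒰, ENNReal.ofReal (‖(smoothedVector W (wordDerivWeight (AutomorphyDatum.gl 2 K hc₀).ofArch u θ) f :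
            (AdelicGroupData.gl 2 K).L2 μ)‖ ^ 2) := hKLB W θ hθt hθU f
      _ ≤ C * wordsBound W f η 𝒰 := by
          refine mul_le_mul' le_rfl (Finset.sum_le_sum fun u _ => ENNReal.ofReal_le_ofReal ?_)
          have h := norm_smoothedVector_wordDerivWeight_leftTranslate_le hc₀ W hη had (kGL_mem k) u f
          rw [← hθ] at h
          rw [Submodule.coe_norm]
          exact pow_le_pow_left₀ (norm_nonneg _) h 2
  -- Step 4: finiteness
  have hMtop : wordsBound W f η 𝒰 ≠ ⊤ := wordsBound_ne_top W f η 𝒰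
  calc (c₂ : ℝ≥0∞) * ∫⁻ k, ∑' m : ↥S' → ℤ, ∫⁻ x, shellPsi Wf ϖ S' m k x ∂mixedUnitsHaar K ∂νK
      ≤ c₂ * ∫⁻ _k, C * wordsBound W f η 𝒰 ∂νK := mul_le_mul' le_rfl (lintegral_mono hk)
    _ = c₂ * (C * wordsBound W f η 𝒰 * νK Set.univ) := by rw [lintegral_const]
    _ < ⊤ := ENNReal.mul_lt_top ENNReal.coe_lt_top (ENNReal.mul_lt_top (ENNReal.mul_lt_top hC.lt_top hMtop.lt_top) (measure_lt_top νK _))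

end YPart

/-! ### The datum and the assembly -/

section Assembly

variable {K : Type} [Field K] [NumberField K]
variable {μ : Measure (AdelicGroupData.gl 2 K).automorphicQuotient} [(AdelicGroupData.gl 2 K).IsAutomorphicMeasure μ]

/-- **An `Ad(K_∞)`-invariant test datum in a cuspidal `Π`**: `f ∈ Π`, a test function `η ≥ 0`
invariant under conjugation by `K_∞` with `S_η f ≠ 0`, and a level `𝔫 ≠ 0` under which `η` is left
invariant (as `CuspidalTestVector.exists_isTestFunctionGL_smoothedForm_ne_zero`, keeping the
`Ad(K_∞)`-invariance of `AutomorphicRepsGL.exists_adInvariant_symmetric_testWeight`). [folklore] -/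
theorem CuspidalAutomorphicRepGL.exists_adInvariant_testDatum (P : CuspidalAutomorphicRepGL 2 K μ) :
    ∃ (f : P.1.toSubmodule) (η : (AdelicGroupData.gl 2 K).Adelic → ℝ), IsTestFunctionGL 2 K η ∧
      smoothedForm η (f : (AdelicGroupData.gl 2 K).L2 μ) ≠ 0 ∧
      (∀ (κ : (AutomorphyDatum.gl 2 K (isCompact_glFiniteIntegralLevel_holds 2 K)).arch.maximalCompact)
        (g : (AdelicGroupData.gl 2 K).Adelic),
        η ((AutomorphyDatum.gl 2 K (isCompact_glFiniteIntegralLevel_holds 2 K)).ofK κ * g *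
          ((AutomorphyDatum.gl 2 K (isCompact_glFiniteIntegralLevel_holds 2 K)).ofK κ)⁻¹) = η g) ∧
      ∃ 𝔫 : Ideal (𝓞 K), 𝔫 ≠ 0 ∧ ∀ u ∈ principalCongruenceLevel 2 K 𝔫, ∀ g : GL (Fin 2) (AdeleRing (𝓞 K) K), η (u * g) = η g := by
  haveI : Nontrivial P.1.toSubmodule := ((ContRepresentation.isTopIrreducible_iff _).1 P.isTopIrreducible).1
  obtain ⟨f, hf0⟩ := exists_ne (0 : P.1.toSubmodule)
  set F := ((f : P.1.toSubmodule) : (AdelicGroupData.gl 2 K).L2 μ) with hF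
  set V : Set (AdelicGroupData.gl 2 K).Adelic :=
    {g | ‖F‖ ^ 2 / 2 < RCLike.re (inner ℂ F ((AdelicGroupData.gl 2 K).rightRegular μ g F))} with hV
  have hcont : Continuous fun g => RCLike.re (inner ℂ F ((AdelicGroupData.gl 2 K).rightRegular μ g F)) :=
    RCLike.continuous_re.comp (continuous_const.inner
      ((AdelicGroupData.isStronglyContinuous_rightRegular_holds (AdelicGroupData.gl 2 K) μ) F))
  have hVo : IsOpen V := isOpen_lt continuous_const hcont
  have h1V : (1 : (AdelicGroupData.gl 2 K).Adelic) ∈ V := by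
    change ‖F‖ ^ 2 / 2 < RCLike.re (inner ℂ F ((AdelicGroupData.gl 2 K).rightRegular μ 1 F))
    rw [map_one]
    change ‖F‖ ^ 2 / 2 < RCLike.re (inner ℂ F F)
    rw [inner_self_eq_norm_sq_to_K]
    norm_cast
    have hF0 : F ≠ 0 := fun h => hf0 (Subtype.ext h)
    have : 0 < ‖F‖ ^ 2 := by positivity
    linarith
  obtain ⟨U, -, η, hη, hη0, -, had, -, hmass, hsupp⟩ :=
    AutomorphicRepsGL.exists_adInvariant_symmetric_testWeight_holds 2 K (isCompact_glFiniteIntegralLevel_holds 2 K) V (hVo.mem_nhds h1V)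
  have hne : smoothedVector P.1 η f ≠ 0 :=
    smoothedVector_ne_zero_of_support_subset P.1 hη.continuous hη.hasCompactSupport hη0 hmass hf0 hsupp
  have hFne : smoothedForm η F ≠ 0 := smoothedForm_ne_zero_of_smoothedVector_ne_zero hη.continuous hη.hasCompactSupport hne
  obtain ⟨𝔫, h𝔫, hηK⟩ := hη.exists_forall_mul_left_eq
  exact ⟨f, η, hη, hFne, had, 𝔫, h𝔫, fun u hu g => hηK u hu g⟩

/-- The torus weight at `s = 1` in rank `2` is `‖a₁‖²`. [folklore] -/
theorem torusWeight_two_one (a : Fin 2 → ideleGroup K) : torusWeight 2 K 1 a = (IdeleClassGroup.ideleNorm K (a 1) : ℝ) ^ 2 := by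
  rw [torusWeight, Fin.prod_univ_two]
  simp only [Fin.val_zero, Fin.val_one, Nat.cast_zero, Nat.cast_one, Nat.cast_ofNat]
  norm_num

variable [MeasurableSpace (AdeleRing (𝓞 K) K)] [BorelSpace (AdeleRing (𝓞 K) K)]

/-- The second-coordinate majorant `G(t) = C_K exp(-‖ι(t_∞)‖/√2) ‖t‖² 𝟙{|t|_v ≤ 1, v ∈ S'}`. [folklore] -/
def sndMajorant (S' : Finset (HeightOneSpectrum (𝓞 K))) (t : ideleGroup K) : ℝ≥0∞ :=
  ENNReal.ofReal (gaussJsConst K * Real.exp (-((Real.sqrt 2)⁻¹ * ‖((archUnitsOfIdele K t : (mixedSpace K)ˣ) : mixedSpace K)‖)) *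
      (IdeleClassGroup.ideleNorm K t : ℝ) ^ 2) *
    (if ∀ v ∈ S', Valued.v (((t : ideleGroup K) : AdeleRing (𝓞 K) K).2 v) ≤ 1 then 1 else 0)

omit [MeasurableSpace (AdeleRing (𝓞 K) K)] [BorelSpace (AdeleRing (𝓞 K) K)] in
set_option maxHeartbeats 1600000 in
/-- **The pointwise bound of the torus integrand**: for `k ∈ K` and the smoothed cusp form of a
cuspidal `Π`,
`|W(diag(a) k)|² Φ(e_2 diag(a) k) ‖a₁‖² ≤ |W(diag(a₀ a₁⁻¹, 1) k)|² · G(a₁)`. [cite: JacquetShalikaAJM1981, §4] -/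
theorem torusIntegrand_le_shear_mul_sndMajorant (P : CuspidalAutomorphicRepGL 2 K μ)
    (ν₀ : Measure ↥(adelicUnipotent 2 K)) (η : (AdelicGroupData.gl 2 K).Adelic → ℝ) (f : P.1.toSubmodule)
    (S' : Finset (HeightOneSpectrum (𝓞 K))) (a : Fin 2 → ideleGroup K) (k : ↥(maximalCompactAdelic 2 K)) :
    torusIntegrand 2 K (whittakerCoeff ν₀ (unipotentTateDomain 2 K) (adeleAddChar K)
        (invQuot (AdelicGroupData.gl 2 K) (smoothedForm η (f : (AdelicGroupData.gl 2 K).L2 μ))))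
      (standardTestFun 2 K (gaussArchTestFun 2 K)) 1 (a, k) ≤
      ‖whittakerCoeff ν₀ (unipotentTateDomain 2 K) (adeleAddChar K)
          (invQuot (AdelicGroupData.gl 2 K) (smoothedForm η (f : (AdelicGroupData.gl 2 K).L2 μ)))
          (glDiagonal 2 (AdeleRing (𝓞 K) K) (shearTorus a) * kGL k)‖ₑ ^ 2 * sndMajorant S' (a 1) := by
  set W := whittakerCoeff ν₀ (unipotentTateDomain 2 K) (adeleAddChar K)
    (invQuot (AdelicGroupData.gl 2 K) (smoothedForm η (f : (AdelicGroupData.gl 2 K).L2 μ))) with hW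
  have htp : torusPoint 2 K (a, k) = glDiagonal 2 (AdeleRing (𝓞 K) K) a * kGL k := rfl
  unfold torusIntegrand sndMajorant
  rw [htp, torusWeight_two_one, hW, norm_whittakerCoeff_glDiagonal_two_eq P, ← hW]
  set Φv := standardTestFun 2 K (gaussArchTestFun 2 K) (lastRow 2 K (glDiagonal 2 (AdeleRing (𝓞 K) K) a * kGL k)) with hΦv
  have hΦle : Φv ≤ gaussJsConst K * Real.exp (-((Real.sqrt 2)⁻¹ * ‖((archUnitsOfIdele K (a 1) : (mixedSpace K)ˣ) : mixedSpace K)‖)) := by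
    have h := standardTestFun_gauss_lastRow_le (a := a) (kGL_mem k)
    rwa [div_eq_inv_mul] at h
  by_cases hint : ∀ v ∈ S', Valued.v (((a 1 : ideleGroup K) : AdeleRing (𝓞 K) K).2 v) ≤ 1
  · rw [if_pos hint, mul_one]
    have e1 : ‖W (glDiagonal 2 (AdeleRing (𝓞 K) K) (shearTorus a) * kGL k)‖ₑ ^ 2 =
        ENNReal.ofReal (‖W (glDiagonal 2 (AdeleRing (𝓞 K) K) (shearTorus a) * kGL k)‖ ^ 2) := by
      rw [ENNReal.ofReal_pow (norm_nonneg _), ofReal_norm]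
    rw [e1, ← ENNReal.ofReal_mul (sq_nonneg _)]
    refine ENNReal.ofReal_le_ofReal ?_
    rw [mul_assoc]
    refine mul_le_mul_of_nonneg_left ?_ (sq_nonneg _)
    exact mul_le_mul_of_nonneg_right hΦle (sq_nonneg _)
  · -- `Φ` vanishes
    have hΦz : Φv = 0 := by
      by_contra hne
      exact hint fun v _ => valued_snd_le_one_of_standardTestFun_lastRow_ne_zero (gaussArchTestFun 2 K) k hne v
    rw [hΦz, mul_zero, zero_mul, ENNReal.ofReal_zero]
    exact bot_le

end Assembly

/-! ### The main theorem -/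

section Main

variable {K : Type} [Field K] [NumberField K]
variable {μ : Measure (AdelicGroupData.gl 2 K).automorphicQuotient} [(AdelicGroupData.gl 2 K).IsAutomorphicMeasure μ]
variable [MeasurableSpace (AdeleRing (𝓞 K) K)] [BorelSpace (AdeleRing (𝓞 K) K)]

omit [MeasurableSpace (AdeleRing (𝓞 K) K)] [BorelSpace (AdeleRing (𝓞 K) K)] in
/-- The set of ideles integral at the places of `T` is closed. [folklore] -/
theorem isClosed_setOf_forall_valued_le_one (T : Finset (HeightOneSpectrum (𝓞 K))) :
    IsClosed {t : ideleGroup K | ∀ v ∈ T, Valued.v (((t : ideleGroup K) : AdeleRing (𝓞 K) K).2 v) ≤ 1} := by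
  have h : {t : ideleGroup K | ∀ v ∈ T, Valued.v (((t : ideleGroup K) : AdeleRing (𝓞 K) K).2 v) ≤ 1} =
      ⋂ v ∈ T, {t : ideleGroup K | ‖AdelicGroupData.adeleEval K v ((t : ideleGroup K) : AdeleRing (𝓞 K) K)‖ ≤ 1} := by
    ext t
    simp only [Set.mem_setOf_eq, Set.mem_iInter, Valued.toNormedField.norm_le_one_iff, AdelicGroupData.adeleEval_apply]
  rw [h]
  refine isClosed_biInter fun v _ => ?_
  exact isClosed_le (continuous_norm.comp ((AdelicGroupData.continuous_adeleEval K v).comp Units.continuous_val)) continuous_const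

omit [MeasurableSpace (AdeleRing (𝓞 K) K)] [BorelSpace (AdeleRing (𝓞 K) K)] in
/-- The archimedean exponential factor is continuous on `𝕀_K`. [folklore] -/
theorem continuous_exp_neg_norm_archUnitsOfIdele (c : ℝ) :
    Continuous fun t : ideleGroup K => Real.exp (-(c * ‖((archUnitsOfIdele K t : (mixedSpace K)ˣ) : mixedSpace K)‖)) := by
  have h1 : Continuous fun t : ideleGroup K => ((archUnitsOfIdele K t : (mixedSpace K)ˣ) : mixedSpace K) :=
    Units.continuous_val.comp continuous_archUnitsOfIdele
  exact Real.continuous_exp.comp ((continuous_const.mul (continuous_norm.comp h1))).neg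

omit [MeasurableSpace (AdeleRing (𝓞 K) K)] [BorelSpace (AdeleRing (𝓞 K) K)] in
/-- The real factor of the majorant is continuous. [folklore] -/
theorem continuous_sndMajorant_real (C c : ℝ) :
    Continuous fun t : ideleGroup K => C * Real.exp (-(c * ‖((archUnitsOfIdele K t : (mixedSpace K)ˣ) : mixedSpace K)‖)) *
      (IdeleClassGroup.ideleNorm K t : ℝ) ^ 2 := by
  have h2 : Continuous fun t : ideleGroup K => (IdeleClassGroup.ideleNorm K t : ℝ) :=
    NNReal.continuous_coe.comp (continuous_ideleNorm_holds K)
  exact (continuous_const.mul (continuous_exp_neg_norm_archUnitsOfIdele c)).mul (h2.pow 2)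

/-- The second-coordinate majorant is measurable. [folklore] -/
theorem measurable_sndMajorant (T : Finset (HeightOneSpectrum (𝓞 K))) : Measurable (sndMajorant (K := K) T) := by
  haveI : T2Space (AdeleRing (𝓞 K) K) := t2Space_adeleRing K
  haveI := borelSpace_ideleGroup K
  have h1 : Measurable fun t : ideleGroup K => ENNReal.ofReal (gaussJsConst K *
      Real.exp (-((Real.sqrt 2)⁻¹ * ‖((archUnitsOfIdele K t : (mixedSpace K)ˣ) : mixedSpace K)‖)) * (IdeleClassGroup.ideleNorm K t : ℝ) ^ 2) :=
    ENNReal.measurable_ofReal.comp (continuous_sndMajorant_real _ _).measurable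
  have h2 : Measurable fun t : ideleGroup K =>
      (if ∀ v ∈ T, Valued.v (((t : ideleGroup K) : AdeleRing (𝓞 K) K).2 v) ≤ 1 then (1 : ℝ≥0∞) else 0) :=
    Measurable.ite (isClosed_setOf_forall_valued_le_one T).measurableSet measurable_const measurable_const
  exact h1.mul h2

set_option maxHeartbeats 3200000 in
/-- **The bad-place Rankin–Selberg torus integral of `GL_2` at `s = 1` converges** (hypothesis `hfin` of
`JacquetShalika1981_partialPairL_pole_of_eq_conj_of_firstMoment` in rank `2`): for every cuspidal `Π` of
`GL_2(𝔸_K)` there are `f ∈ Π` and a test function `η` with `S_η f ≠ 0` such that for every finite set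
`S'` of finite places and all Haar measures
`∫_{B(S'ᶜ) × K} |W_{S_η f}(diag(a) k)|² Φ(e_2 diag(a) k) |det a| δ_B(a)⁻¹ < ∞`.
[cite: JacquetShalikaAJM1981, §4–§5] -/
theorem kirillov_firstMoment_hypothesis_two (P : CuspidalAutomorphicRepGL 2 K μ) :
    ∃ (f : P.1.toSubmodule) (η : (AdelicGroupData.gl 2 K).Adelic → ℝ), IsTestFunctionGL 2 K η ∧
      smoothedForm η (f : (AdelicGroupData.gl 2 K).L2 μ) ≠ 0 ∧
      ∀ (S' : Set (HeightOneSpectrum (𝓞 K))), S'.Finite →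
        ∀ (νA : Measure (Fin 2 → ideleGroup K)) (_ : IsHaarMeasure νA)
          (νK : Measure ↥(maximalCompactAdelic 2 K)) (_ : IsHaarMeasure νK)
          (ν₀ : Measure ↥(adelicUnipotent 2 K)) (_ : IsHaarMeasure ν₀),
          ∫⁻ p in unitBox {v | v ∉ S'} ×ˢ Set.univ, torusIntegrand 2 K
              (whittakerCoeff ν₀ (unipotentTateDomain 2 K) (adeleAddChar K)
                (invQuot (AdelicGroupData.gl 2 K) (smoothedForm η (f : (AdelicGroupData.gl 2 K).L2 μ))))
              (standardTestFun 2 K (gaussArchTestFun 2 K)) 1 p ∂(νA.prod νK) ≠ ⊤ := by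
  obtain ⟨f, η, hη, hne, had, 𝔫, h𝔫, hηK⟩ := P.exists_adInvariant_testDatum
  refine ⟨f, η, hη, hne, fun S' hS' νA hνA νK hνK ν₀ hν₀ => ?_⟩
  haveI := hνA; haveI := hνK; haveI := hν₀
  -- topological and measurable structures
  haveI : T2Space (GL (Fin 2) (AdeleRing (𝓞 K) K)) := t2Space_gl 2 K
  haveI : T2Space (AdeleRing (𝓞 K) K) := t2Space_adeleRing K
  haveI := borelSpace_ideleGroup K
  haveI := locallyCompactSpace_ideleGroup K
  haveI := secondCountableTopology_ideleGroup K
  haveI : CompactSpace ↥(maximalCompactAdelic 2 K) := isCompact_iff_compactSpace.1 (isCompact_maximalCompactAdelic 2 K)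
  haveI : SecondCountableTopology ↥(maximalCompactAdelic 2 K) := TopologicalSpace.Subtype.secondCountableTopology _
  haveI : BorelSpace (mixedSpace K)ˣ := Literature.MeasureTheory.Group.Units.borelSpace_of_isOpenEmbedding
  -- the finite set, a Haar measure on the ideles, uniformizers
  set T : Finset (HeightOneSpectrum (𝓞 K)) := hS'.toFinset with hT
  have hTS : {v : HeightOneSpectrum (𝓞 K) | v ∉ S'} = {w | w ∉ T} := by
    ext v; simp [hT, Set.Finite.mem_toFinset]
  obtain ⟨ν₁, hν₁⟩ := exists_isHaarMeasure_ideleGroup K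
  haveI := hν₁
  obtain ⟨ϖ, hϖ⟩ := exists_uniformizers (K := K)
  -- the Whittaker coefficient, the Schwartz function, measurability
  set Wf : GL (Fin 2) (AdeleRing (𝓞 K) K) → ℂ := whittakerCoeff ν₀ (unipotentTateDomain 2 K) (adeleAddChar K)
    (invQuot (AdelicGroupData.gl 2 K) (smoothedForm η (f : (AdelicGroupData.gl 2 K).L2 μ))) with hWf
  have hψ : IsGlobalAddChar K (adeleAddChar K) := isGlobalAddChar_adeleAddChar (K := K)
  have hWc : Continuous Wf := continuous_whittakerCoeff measurableSet_unipotentTateDomain isCompact_closure_unipotentTateDomain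
    hψ.continuous (continuous_invQuot_smoothedForm hη.continuous hη.hasCompactSupport _)
  set Φ : (Fin 2 → AdeleRing (𝓞 K) K) → ℝ := standardTestFun 2 K (gaussArchTestFun 2 K) with hΦ
  have hΦc : Continuous Φ := continuous_standardTestFun_of_continuous 2 K (continuous_gaussArchTestFun 2 K)
  have hΦm : Measurable fun g : GL (Fin 2) (AdeleRing (𝓞 K) K) => Φ (lastRow 2 K g) := (hΦc.comp continuous_lastRow).measurable
  have hmeas : Measurable (torusIntegrand 2 K Wf Φ 1) := measurable_torusIntegrand hWc hΦm 1
  -- the `y`-kernel `Y(y) = ∫_K |W(diag(y, 1) k)|² dν_K`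
  have hYjoint : Measurable (Function.uncurry fun (y : ideleGroup K) (k : ↥(maximalCompactAdelic 2 K)) =>
      ‖Wf (glDiagonal 2 (AdeleRing (𝓞 K) K) ![y, 1] * kGL k)‖ₑ ^ 2) := by
    have hc : Continuous fun p : ideleGroup K × ↥(maximalCompactAdelic 2 K) => Wf (glDiagonal 2 (AdeleRing (𝓞 K) K) ![p.1, 1] * kGL p.2) :=
      hWc.comp ((continuous_glDiagonal_vec2.comp continuous_fst).mul (continuous_subtype_val.comp continuous_snd))
    exact hc.measurable.enorm.pow_const 2
  have hYm : Measurable fun y : ideleGroup K => ∫⁻ k, ‖Wf (glDiagonal 2 (AdeleRing (𝓞 K) K) ![y, 1] * kGL k)‖ₑ ^ 2 ∂νK :=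
    Measurable.lintegral_prod_right' (f := fun p : ideleGroup K × ↥(maximalCompactAdelic 2 K) =>
      ‖Wf (glDiagonal 2 (AdeleRing (𝓞 K) K) ![p.1, 1] * kGL p.2)‖ₑ ^ 2) hYjoint
  -- the two one-variable factors
  set UB : Set (ideleGroup K) := ideleUnitBox (K := K) {w | w ∉ T} with hUB
  have hUBm : MeasurableSet UB := measurableSet_ideleUnitBox_compl ϖ hϖ T
  set F₁ : ideleGroup K → ℝ≥0∞ := UB.indicator fun y => ∫⁻ k, ‖Wf (glDiagonal 2 (AdeleRing (𝓞 K) K) ![y, 1] * kGL k)‖ₑ ^ 2 ∂νK with hF₁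
  set F₂ : ideleGroup K → ℝ≥0∞ := UB.indicator (sndMajorant T) with hF₂
  have hF₁m : Measurable F₁ := hYm.indicator hUBm
  have hF₂m : Measurable F₂ := (measurable_sndMajorant T).indicator hUBm
  -- Step 1: the iterated integral and the pointwise bound
  have hI : ∫⁻ p in unitBox {v | v ∉ S'} ×ˢ Set.univ, torusIntegrand 2 K Wf Φ 1 p ∂(νA.prod νK) ≤
      ∫⁻ a, F₁ (a 0 * (a 1)⁻¹) * F₂ (a 1) ∂νA := by
    rw [← Measure.prod_restrict, Measure.restrict_univ,
      lintegral_prod _ hmeas.aemeasurable, ← lintegral_indicator (measurableSet_unitBox _)]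
    · refine lintegral_mono fun a => ?_
      by_cases ha : a ∈ unitBox (n := 2) (K := K) {v | v ∉ S'}
      · rw [Set.indicator_of_mem ha]
        have ha1 : a 1 ∈ UB := fun w hw => by rw [← hTS] at hw; exact ha w hw 1
        have ha0 : a 0 * (a 1)⁻¹ ∈ UB := by
          intro w hw
          rw [← hTS] at hw
          rw [GaloisRepresentations.ideleGroup_val_snd_mul, GaloisRepresentations.ideleGroup_val_inv_snd, map_mul, map_inv₀,
            ha w hw 0, ha w hw 1, inv_one, mul_one]
        rw [hF₁, hF₂, Set.indicator_of_mem ha0, Set.indicator_of_mem ha1, ← lintegral_mul_const _ (hYjoint.of_uncurry_left)]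
        refine lintegral_mono fun k => ?_
        exact torusIntegrand_le_shear_mul_sndMajorant P ν₀ η f T a k
      · rw [Set.indicator_of_notMem ha]; exact bot_le
  -- Step 2: the shear
  have hshear := lintegral_shear_mul_eq νA ν₁ hF₁m hF₂m
  -- Step 3: the `y`-factor is finite
  have h1 : ∫⁻ y, F₁ y ∂ν₁ < ⊤ := by
    rw [hF₁, lintegral_indicator hUBm, hUB, setLIntegral_ideleUnitBox_eq_tsum ϖ ν₁ hϖ T]
    exact yPart_tsum_lintegral_lt_top P.1 f hη had h𝔫 hηK ν₁ νK ν₀ ϖ hϖ T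
  -- Step 4: the `a₁`-factor is finite
  have h2 : ∫⁻ t, F₂ t ∂ν₁ < ⊤ := by
    rw [hF₂, lintegral_indicator hUBm, hUB]
    exact setLIntegral_ideleUnitBox_expWeight_lt_top ν₁ T (gaussJsConst_pos (K := K)).le (inv_pos.2 (Real.sqrt_pos.2 (by norm_num)))
  -- conclusion
  refine ne_top_of_le_ne_top ?_ hI
  rw [hshear]
  exact (ENNReal.mul_lt_top ENNReal.coe_lt_top (ENNReal.mul_lt_top h1 h2)).ne

end Main

/-! ### Arthur–Clozel (2.3) in rank `2` -/

section RankTwo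

variable {K : Type} [Field K] [NumberField K]
variable {μ : Measure (AdelicGroupData.gl 2 K).automorphicQuotient} [(AdelicGroupData.gl 2 K).IsAutomorphicMeasure μ]

/-- **Arthur–Clozel (2.3) / Jacquet–Shalika II, Prop. 3.6 for `GL_2`**: for unitary cuspidal
`π ≅ σ̃` of `GL_2(𝔸_K)` the limit `lim_{s → 1⁺} (s - 1) L^S(s, π × σ)` exists and is non-zero — the named
fact `JacquetShalika1981_partialPairL_pole_of_eq_conj` in rank `2`, from the Kirillov `L²`-bound.
[cite: ArthurClozelAMS120, Ch. 3 §2, (2.3), p. 171] -/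
theorem JacquetShalika1981_partialPairL_pole_of_eq_conj_holds_two :
    JacquetShalika1981_partialPairL_pole_of_eq_conj (n := 2) (K := K) (μ := μ) :=
  JacquetShalika1981_partialPairL_pole_of_eq_conj_of_firstMoment fun P => kirillov_firstMoment_hypothesis_two P

end RankTwo

end Literature.NumberTheory.Automorphic
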